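import Mathlib.Data.List.Basic
import HarnessLib

/-!
# [IUTchIII] Corollary 3.12 — the proof's own observations, as a signature (c312 crew, II)

Record-only file (D-0012) of the abc-iut cell; TAKES NO SIDE. Companion of `Cor312Loci.lean` (the
cited loci) and `Cor312Chain.lean` (the steps). The proof of [IUTchIII] Corollary 3.12 (author's kurims
2020 text `paper:url-4b091feeb646`, pp. 174 l. 20 – 186 l. 3) is a review, Steps (i)–(xii) with (xi)
divided into (xi-a)–(xi-h), in which each step draws qualitative conclusions from results cited by name.
`Obs` has one constructor per ASSERTION THE PROOF ITSELF MAKES (the conclusions of its steps: "the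
cyclotomes … are insulated from these indeterminacies", the displayed conclusions of (xi-c), (xi-d),
(xi-e), the "subject to the condition" sentence of (xi-f), …), docstring = the printed sentence, verbatim
core, with page and line of the kurims text. Nothing is asserted: a reading of the proof grants some of
them (`O : Obs → Prop`), and `Cor312Chain.lean` types each step as "cited loci ∧ earlier observations ⟹
this step's observations". The one observation that touches real numbers is `comparableObjects` (xi-d)
— "`ℝ_{≤−|log(Θ)|} := {λ ∈ ℝ | λ ≤ −|log(Θ)|} ⊆ ℝ; −|log(q)| ∈ ℝ`" — and the one the three printed
readings (author / Scholze–Stix / LANA) read differently is `constitutesConstruction` (xi-f).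
Source read on the page: [IUTchIII] kurims text pp. 174–186 (this seat, 2026-08-25).
[claim: Mochizuki2012, status: disputed] — quoting a disputed text asserts nothing. Deliberately NOT
here: the cited loci (sibling I), the steps and the real numbers (sibling III), any judgement.
-/

namespace Summit.ABC

namespace IUTFork

namespace Cor312Proof

/-- The assertions the proof of Cor. 3.12 ITSELF makes (conclusions of its steps), one constructor each;
docstring = verbatim core of the printed sentence (kurims pp. 174–186; italics lost). These are the
proof's own words, typed as opaque propositions to be granted or not by a reading `O : Obs → Prop`;
nothing here asserts them. [claim: Mochizuki2012, status: disputed] -/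
inductive Obs
  /-- opening ¶ p. 175 l. 11–13: "we may restrict our attention to possible images of a Θ-pilot object that
  correspond to data [i.e., collections of regions] that may be interpreted as an `F^{⊩▶}`-prime-strip." -/
  | restrictToStrips
  /-- (i) p. 175 l. 32–47: "This poly-isomorphism may be thought of as consisting of a "unit portion" …
  [`F^{⊢×μ}`-prime-strips] and a "value group portion" … [`F^{⊩▶}`-prime-strips]". -/
  | linkSplits
  /-- (i) p. 175 l. 47–49: "This value group portion of the Θ×μ_LGP-link maps Θ-pilot objects of
  `^{0,0}HT^{Θ±ell}NF` to `q`-pilot objects of `^{1,0}HT^{Θ±ell}NF`". -/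
  | valueGroupMapsPilots
  /-- (ii) p. 175 l. 50–52: "the units … are subject to `Aut_{F^{⊢×μ}}(−)`-indeterminacies [i.e., "(Ind1), (Ind2)"]". -/
  | unitsSubjectInd12
  /-- (ii) p. 175 l. 53–57: "the cyclotomes that appear in the Kummer theory surrounding the étale theta
  function and `κ`-coric functions, i.e., which give rise to the "value group portion" …, are insulated
  from these `Aut_{F^{⊢×μ}}(−)`-indeterminacies". -/
  | cyclotomesInsulated
  /-- (iii) p. 176 l. 24–33: "the non-commutativity of the log-theta-lattice renders it practically
  impossible to obtain conclusions that require one to relate both the unit and the value group portions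
  simultaneously [via different links] … This is precisely why we concentrate on a single Θ×μ_LGP-link". -/
  | singleLinkNecessary
  /-- (iv) p. 176 l. 40 – p. 177 l. 8: "The solution to the problem of simultaneously accommodating these
  apparently contradictory requirements … is given precisely by working, on the 0-column, with structures
  that are invariant with respect to vertical shifts … only at the cost of admitting the "indeterminacy"
  constituted by the upper semi-compatibility of (Ind3)." -/
  | verticalShiftSolved
  /-- (v) p. 177 l. 9–23: units on the 0- and 1-columns related "by means of the unit portion … of the
  Θ×μ_LGP-link … and then applying the bi-coricity of the units"; mono-analytic log-shells regarded "as
  "multiradial mono-analytic containers"". -/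
  | unitsRelatedContainers
  /-- (v) p. 177 l. 26–34: "we will relate the … local units …, splitting monoids …, global Frobenioids
  indexed by `(0,m)` … to the vertically coric … versions of these bi-coric mono-analytic containers by
  means of the log-Kummer correspondences of Theorem 3.11, (ii), (a), (b), (c)". -/
  | frobeniusLikeRelatedToCoric
  /-- (vi) p. 177 l. 35–44: the log-Kummer correspondences (ii)(b),(c) "are obtained precisely as a
  consequence of the splittings, up to roots of unity, … constructed by applying the Galois evaluation
  operations"; the Kummer theory of local LGP-monoids "depends, in an essential way, on … [IUTchII], §3 …
  which, in turn, depends … on … [EtTh]". -/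
  | logKummerViaGaloisEvaluation
  /-- (vi) p. 178 l. 12–16: "it is precisely by establishing this conjugate synchronization arising from the
  `F^{⋊±}_l`-symmetry relative to these basepoints that occur on either side of the log-link that one is able
  to conclude the crucial compatibility of this conjugate synchronization with the log-link". -/
  | conjSyncLogLinkCompatible
  /-- (vi) p. 178 l. 17 – p. 179 l. 5 + Fig. 3.7: the three approaches to cyclotomic rigidity (mono-theta:
  multiradial; MLF-Galois pairs: uniradial; number fields via `ℚ_{>0} ∩ Ẑ^× = {1}`: multiradial) "are mutually
  compatible in the sense that they yield the same cyclotomic rigidity isomorphism in any setting in which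
  more than one of these approaches may be applied." -/
  | cycRigidityApproaches
  /-- (vii) p. 179 l. 19–38: the bi-coricity depends on the `F^{⋊±}_l` conjugate synchronization, which is
  "fundamentally incompatible with the `F^⋇_l`-symmetry, [so] it is necessary to work with these two symmetries
  separately"; the `F^⋇_l`-symmetry "allows one to "descend to `F_mod`"". -/
  | symmetriesSeparate
  /-- (vii) p. 179 l. 38 – p. 180 l. 10: "both the `F^{⋊±}_l`- and `F^⋇_l`-symmetries share the property of being
  compatible with the vertical coricity and relevant Kummer isomorphisms of the 0-column … Here, we recall
  that the vertically coric versions of both the `F^{⋊±}_l`- and the `F^⋇_l`-symmetries depend, in an essential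
  way, on the arithmetic holomorphic structure of the 0-column, hence give rise to multiradial structures via
  the tautological approach to constructing such structures discussed in Remark 3.11.2, (i), (ii)." -/
  | symmetriesMultiradial
  /-- (viii) p. 180 l. 11–20: the global ±-synchronizations "give rise to profinite conjugacy indeterminacies
  in the vertically coric construction of the LGP-monoids … which are resolved by applying the theory of
  [IUTchI], §2". -/
  | conjugacyIndetResolved
  /-- (ix) p. 180 l. 21–42: "the ring structure of the global field `F_mod` … furnishes a translation apparatus
  — between the multiplicative structures constituted by the global realified Frobenioids related via the
  Θ×μ_LGP-link and the additive representations … that arise from the "mono-analytic containers""; `F^⊛_MOD`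
  "better suited to describing the relation to the Θ×μ_LGP-link", `F^⊛_mod` "to explicit estimates". -/
  | fmodTranslation
  /-- (x) p. 180 l. 43–60: "The theory of "Kummer-detachment" … furnished by Theorem 3.11, (ii), (iii),
  allows one to relate the Frobenioid-theoretic … structures … at (0,0) … to the multiradial representation
  … but only at the cost of introducing the indeterminacies (Ind1) … (Ind2) … (Ind3)". -/
  | kummerDetachmentInd123
  /-- (x) p. 181 l. 5–13: "the procession-normalized mono-analytic log-volumes … furnish a means of
  constructing a sort of associated "coarse space" … in the sense that … the resulting log-volumes `∈ ℝ` are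
  invariant with respect to the indeterminacies (Ind1), (Ind2), and have the effect of converting the
  indeterminacy (Ind3) into an inequality [from above]." -/
  | logvolInvariantInequality
  /-- (x) p. 181 l. 13–18: "the log-link compatibility of the various log-volumes … ensures that these
  log-volumes are compatible with … the various arrows … of the log-Kummer correspondence". -/
  | logvolLogLinkCompatible
  /-- (x) p. 181 l. 26–32: "the various tensor products that appear in the various local mono-analytic tensor
  packets … have the effect of identifying the operation of "multiplication by elements of `ℤ`" — and hence
  also the effect on log-volumes of such multiplication operations! — at different labels `∈ F^⋇_l`." -/
  | tensorIdentifiesMultZ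
  /-- (xi-a) p. 181 l. 37–44: "the Θ×μ_LGP-link from (0,0) to (1,0) may be interpreted as a sort of gluing
  isomorphism … in such a way that the Θ-pilot object at (0,0) … corresponds to the `q`-pilot object at (1,0)". -/
  | linkAsGluing
  /-- (xi-b) p. 181 l. 45–56: "the multiradial construction algorithm of Theorem 3.11 … yields a construction
  of a collection of possibilities of output data contained in `(^{0,∘}U^Q ⊇) ^{0,∘}U ⥲ ^{1,∘}U (⊆ ^{1,∘}U^Q)` …
  that satisfies the input prime-strip link (IPL) and simultaneous holomorphic expressibility (SHE) properties". -/
  | outputSatisfiesIPLSHE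
  /-- (xi-b) p. 182 l. 2–7: "the `F^{⊩▶}`-prime-strip portion of the link/relationship of this collection of
  possibilities of output data to the input data (`F^{⊩▶×μ}`-)prime-strip … consists precisely of (full
  poly-)isomorphisms of `F^{⊩▶}`-prime-strips, while the corresponding link/relationship for
  `F^{⊢×μ}`-prime-strips is somewhat more complicated, as a result of the indeterminacies (Ind1), (Ind2), (Ind3)." -/
  | valueGroupLinkFullPolyIso
  /-- (xi-b) p. 182 l. 8–24: "we shall only be concerned with qualitative logical aspects/consequences of this
  construction algorithm, i.e., with the (IPL), (SHE), (APT) properties … "temporarily forgetting" [(HIS)] …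
  think of the multiradial construction algorithm … as "some" algorithm that transforms a certain type of
  input data into a certain type of output data and, moreover, satisfies certain properties (IPL) and (SHE)." -/
  | onlyQualitative
  /-- (xi-c) display p. 182 l. 27–33: "The multiradial construction algorithm of Theorem 3.11 yields a
  collection of possibilities of output data in `^{1,∘}U (⊆ ^{1,∘}U^Q)` that are linked/related [cf. (IPL)], via
  isomorphisms of `F^{⊩▶}`-prime-strips, to the representation [via the log-Kummer correspondence in the
  1-column] of the `q`-pilot object at (1,0) on `^{1,∘}U^Q`, and, moreover, whose construction may be expressed
  entirely relative to the arithmetic holomorphic structure in the 1-column [cf. (SHE)]." -/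
  | displayXIc
  /-- (xi-c) p. 182 l. 36–46: "by slightly enlarging the collection of possibilities of output data … by
  working with the holomorphic hull … we obtain output data that is expressed … in terms of localizations of
  arithmetic vector bundles over certain local rings labeled "`1,∘`" … necessary in order to render the output
  data in a form that is comparable to the representation of the `q`-pilot object". -/
  | hullGivesVectorBundles
  /-- (xi-d) display p. 183 l. 3–10: as `displayXIc` with "followed by formation of the holomorphic hull" and
  "expressed entirely relative to localizations of arithmetic vector bundles over rings that arise in the
  arithmetic holomorphic structure in the 1-column [cf. (SHE)]". -/
  | displayXId
  /-- (xi-d) p. 183 l. 14–24: "it is only by forming [a suitable positive tensor power of] the determinant …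
  and then applying the [suitably normalized, with respect to `j ∈ |F_l|`] log-volume to various regions —
  i.e., the region `^{1,∘}U` and the region that arises from the representation of the `q`-pilot object at
  (1,0) on `^{1,∘}U^Q` … that we are able to obtain completely comparable objects …, namely,
  `ℝ_{≤−|log(Θ)|} := {λ ∈ ℝ | λ ≤ −|log(Θ)|} ⊆ ℝ; −|log(q)| ∈ ℝ`". The REAL NUMBERS enter here
  (`Cor312Chain.Volumes`). -/
  | comparableObjects
  /-- (xi-d) p. 183 l. 28–32: "global arithmetic degrees of objects of global realified Frobenioids may be
  interpreted as log-volumes". -/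
  | degreesAsLogVolumes
  /-- (xi-d) p. 183 l. 32–42: "it is of crucial importance to apply the log-Kummer correspondence in the
  1-column … in order to rectify the vertical shift/mismatch … between the unit portion of `^{1,0}F^{⊩▶×μ}_△` and
  the log-shells arising from … this unit portion, which give rise to the tensor packets of log-shells that
  constitute `^{1,∘}U`." -/
  | oneColumnLogKummerRectifies
  /-- (xi-e) p. 183 l. 43 – p. 184 l. 9: "the relationship … between the pilot-object log-volume `−|log(q)| ∈ ℝ`
  and the input data (`F^{⊩▶×μ}`-)prime-strip is precisely the relationship prescribed/imposed by the arithmetic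
  holomorphic structure in the 1-column … "expressibility relative to the arithmetic holomorphic structure in
  the 1-column" [cf. (SHE)] amounts precisely to "expressibility via operations that are
  valid/executable/well-defined even when subject to the condition that the pilot-object log-volume associated
  to the input data … be equal to the fixed value `−|log(q)| ∈ ℝ`"." -/
  | sheMeansFixedValue
  /-- (xi-e) display p. 184 l. 11–18: "The multiradial construction algorithm of Theorem 3.11, followed by
  formation of the holomorphic hull and application of the log-volume, yields a collection of possible
  log-volumes of pilot-object output data `ℝ_{≤−|log(Θ)|} ⊆ ℝ` that are linked/related [cf. (IPL)], via
  isomorphisms of `F^{⊩▶}`-prime-strips, to the pilot-object log-volume `−|log(q)| ∈ ℝ` of the input data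
  (`F^{⊩▶×μ}`-)prime-strip [cf. (SHE)]." -/
  | displayXIe
  /-- (xi-f) p. 184 l. 19–25 (THE SENTENCE the three readings read differently): "we conclude from (xi-e) that
  the construction of the subset `ℝ_{≤−|log(Θ)|} ⊆ ℝ` of possible pilot-object log-volumes of output data is
  subject to the condition that this construction of output data possibilities constitutes, in particular,
  a construction [perhaps only up to some sort of "approximation", as a result of various indeterminacies]
  of the pilot-object log-volume of the input data (`F^{⊩▶×μ}`-)prime-strip, namely, `−|log(q)| ∈ ℝ`." -/
  | constitutesConstruction
  /-- (xi-g) p. 184 l. 30–34 + Fig. 3.8 p. 185: "the multiradial construction algorithm of Theorem 3.11,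
  followed by formation of the holomorphic hull and application of the log-volume, yields two tautologically
  equivalent ways to compute the log-volume of the `q`-pilot object at (1,0)". -/
  | twoEquivalentWays
  /-- (xi-h) p. 185 l. 48–58: "the above argument depends, in an essential way …, on the theory of [EtTh],
  which does not admit any evident generalization to the case of `N`-th tensor powers of Θ-pilot objects,
  for `N ≥ 2` … the log-volume of such an `N`-th tensor power … must always be computed as the result of
  multiplying the log-volume of the original Θ-pilot object by `N` … these sharper inequalities are known
  to be false". -/
  | noNthPower
  /-- (xii) p. 185 l. 59 – p. 186 l. 3: "since the isomorphism of [local or global!] Frobenioids arising from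
  the Θ×μ_LGP-link only preserves isomorphism classes of objects …, to work only with local Frobenioids means
  that one must contend with the indeterminacy of not knowing whether … such a local Frobenioid object …
  corresponds to a given open submodule of the log-shell at `v` or to, say, the `p_v^N`-multiple of this
  submodule … This indeterminacy has the effect of rendering meaningless any attempt to perform a precise
  log-volume computation as in (xi)." -/
  | globalFrobenioidsNeeded
  deriving DecidableEq, Repr

namespace Obs

/-- All 36 observations, in the order the proof makes them. [claim: Mochizuki2012, status: disputed] -/
def all : List Obs :=
  [restrictToStrips, linkSplits, valueGroupMapsPilots, unitsSubjectInd12, cyclotomesInsulated,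
   singleLinkNecessary, verticalShiftSolved, unitsRelatedContainers, frobeniusLikeRelatedToCoric,
   logKummerViaGaloisEvaluation, conjSyncLogLinkCompatible, cycRigidityApproaches, symmetriesSeparate,
   symmetriesMultiradial, conjugacyIndetResolved, fmodTranslation, kummerDetachmentInd123,
   logvolInvariantInequality, logvolLogLinkCompatible, tensorIdentifiesMultZ, linkAsGluing,
   outputSatisfiesIPLSHE, valueGroupLinkFullPolyIso, onlyQualitative, displayXIc, hullGivesVectorBundles,
   displayXId, comparableObjects, degreesAsLogVolumes, oneColumnLogKummerRectifies, sheMeansFixedValue,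
   displayXIe, constitutesConstruction, twoEquivalentWays, noNthPower, globalFrobenioidsNeeded]

/-- The list is complete. [folklore] -/
theorem mem_all (o : Obs) : o ∈ all := by cases o <;> decide

/-- … without repetition, of length 36. [folklore] -/
theorem all_nodup_length : all.Nodup ∧ all.length = 36 := by decide

end Obs

end Cor312Proof

end IUTFork

end Summit.ABC
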